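import Mathlib

/-!
# Route OverlapGapAlgebra, crux `SolvableImpliesStableSection` (stmt-PneNP-2463), line `Sketch`:
# Stub 6 `stub_asymptotics` — polynomially small beats exponentially small

The line's engine (the Bresler–Huang resampling-walk lemma) bounds the probability of the crux's
path event from below by `(2n)^(-4kA) - (2n)^(-k²m)` (with `m = ⌊α n⌋₊` clauses; instances are
counted as `(2n)^(mk)` and path tuples as `(2n)^(mk(k+1))`), while the crux asks for `≥ e^(-cn)`.
This file supplies the pure real-analysis comparison, in the multiplied-out form the composition
consumes.

**Claim (`stub_asymptotics`).** For `k ≥ 1` and `α, A, c > 0`, eventually in `n : ℕ`,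

  `e^(-cn) · (2n)^(M(k+1)) + (2n)^M ≤ (2n)^(M(k+1)) · e^(-4kA·log(2n))`,  where `M = ⌊α n⌋₊ · k`.

Dividing by `(2n)^(M(k+1)) > 0` this reads `e^(-cn) + (2n)^(-Mk) ≤ (2n)^(-4kA)`.

**Proof.** Both summands on the left are at most half of the right-hand side, eventually:
* `e^(-cn) ≤ ½ e^(-4kA log(2n))`, i.e. `log 2 + 4kA·log(2n) ≤ c n`: from `log x = o(x)`
  (`Real.isLittleO_log_id_atTop`) along `x = 2n → ∞`;
* `(2n)^M ≤ ½ (2n)^(M(k+1)) e^(-4kA log(2n))`: as `(2n)^(M(k+1)) = (2n)^M (2n)^(Mk)` and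
  `(2n)^(Mk) e^(-4kA log(2n)) = e^((Mk - 4kA) log(2n)) ≥ e^(log 2) = 2` once `Mk ≥ 4kA + 1`
  (because `log(2n) ≥ log 2 > 0`), which holds eventually since `⌊α n⌋₊ → ∞` and `k ≥ 1`.
-/

set_option linter.dupNamespace false

namespace Summit.PneNP.PneNP.Cruxes.SolvableImpliesStableSection.Sketch

open Finset
open scoped Classical

/-- `log x = o(x)` made effective: for `B, c > 0`, eventually `log 2 + B log x ≤ (c/2) x`. -/
private theorem asy_log_bound_real {B c : ℝ} (hB : 0 < B) (hc : 0 < c) :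
    ∀ᶠ x : ℝ in Filter.atTop, Real.log 2 + B * Real.log x ≤ c / 2 * x := by
  have h := Real.isLittleO_log_id_atTop.bound (show (0 : ℝ) < c / (4 * B) by positivity)
  filter_upwards [h, Filter.eventually_ge_atTop (4 * Real.log 2 / c),
    Filter.eventually_ge_atTop (0 : ℝ)] with x hx hx2 hx0
  have hx' : |Real.log x| ≤ c / (4 * B) * |x| := by simpa only [Real.norm_eq_abs, id] using hx
  have h1 : Real.log x ≤ c / (4 * B) * x := by
    rw [abs_of_nonneg hx0] at hx'
    exact (le_abs_self _).trans hx'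
  have h2 : B * Real.log x ≤ c / 4 * x := by
    calc B * Real.log x ≤ B * (c / (4 * B) * x) := mul_le_mul_of_nonneg_left h1 hB.le
      _ = c / 4 * x := by field_simp
  have h3 : 4 * Real.log 2 ≤ x * c := (div_le_iff₀ hc).1 hx2
  linarith

/-- Along `x = 2n`: for `B, c > 0`, eventually in `n : ℕ`, `log 2 + B log(2n) ≤ c n`. -/
private theorem asy_log_bound_nat {B c : ℝ} (hB : 0 < B) (hc : 0 < c) :
    ∀ᶠ n : ℕ in Filter.atTop, Real.log 2 + B * Real.log (2 * n) ≤ c * n := by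
  have ht : Filter.Tendsto (fun n : ℕ => (2 * n : ℝ)) Filter.atTop Filter.atTop :=
    tendsto_natCast_atTop_atTop.const_mul_atTop two_pos
  filter_upwards [ht.eventually (asy_log_bound_real hB hc)] with n hn
  linarith

/-- For `α > 0` the number of clauses `⌊α n⌋₊` eventually exceeds any real bound `R`. -/
private theorem asy_floor_large {α : ℝ} (hα : 0 < α) (R : ℝ) :
    ∀ᶠ n : ℕ in Filter.atTop, R ≤ (⌊α * n⌋₊ : ℝ) := by
  have ht : Filter.Tendsto (fun n : ℕ => ⌊α * (n : ℝ)⌋₊) Filter.atTop Filter.atTop :=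
    tendsto_nat_floor_atTop.comp (tendsto_natCast_atTop_atTop.const_mul_atTop hα)
  filter_upwards [ht.eventually_ge_atTop ⌈R⌉₊] with n hn
  exact (Nat.le_ceil R).trans (by exact_mod_cast hn)

/-- Pointwise form of the comparison: if `x = e^L` with `L ≥ log 2`, `log 2 + B L ≤ t` and
`B + 1 ≤ M k`, then `e^(-t) x^(M(k+1)) + x^M ≤ x^(M(k+1)) e^(-BL)` (each summand is at most half
of the right-hand side). -/
private theorem asy_pointwise {x L B t : ℝ} {M k : ℕ} (hxL : Real.exp L = x)
    (hL : Real.log 2 ≤ L) (ht : Real.log 2 + B * L ≤ t) (hMB : B + 1 ≤ ((M * k : ℕ) : ℝ)) :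
    Real.exp (-t) * x ^ (M * (k + 1)) + x ^ M ≤ x ^ (M * (k + 1)) * Real.exp (-(B * L)) := by
  have hlog2 : 0 < Real.log 2 := Real.log_pos one_lt_two
  have hLpos : 0 < L := hlog2.trans_le hL
  have hxpos : 0 < x := hxL ▸ Real.exp_pos L
  -- the polynomial gain beats the polynomial loss: `2 ≤ x^(Mk) e^(-BL) = e^((Mk - B) L)`
  have hkey : 2 ≤ x ^ (M * k) * Real.exp (-(B * L)) := by
    have h1 : x ^ (M * k) * Real.exp (-(B * L)) = Real.exp (((M * k : ℕ) : ℝ) * L - B * L) := by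
      rw [Real.exp_sub, Real.exp_neg, Real.exp_nat_mul, hxL, div_eq_mul_inv]
    have h2 : (B + 1) * L ≤ ((M * k : ℕ) : ℝ) * L := mul_le_mul_of_nonneg_right hMB hLpos.le
    rw [h1]
    calc (2 : ℝ) = Real.exp (Real.log 2) := (Real.exp_log two_pos).symm
      _ ≤ Real.exp (((M * k : ℕ) : ℝ) * L - B * L) := Real.exp_le_exp.2 (by linarith)
  -- `x^(M(k+1)) = x^M · x^(Mk)`
  have hP : x ^ (M * (k + 1)) = x ^ M * x ^ (M * k) := by
    rw [mul_add_one, pow_add, mul_comm]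
  -- (a) the exponentially small term is at most half of the right-hand side
  have ha : Real.exp (-t) * 2 ≤ Real.exp (-(B * L)) := by
    calc Real.exp (-t) * 2 = Real.exp (-t + Real.log 2) := by
          rw [Real.exp_add, Real.exp_log two_pos]
      _ ≤ Real.exp (-(B * L)) := Real.exp_le_exp.2 (by linarith)
  have ha' : Real.exp (-t) * x ^ (M * (k + 1)) * 2 ≤ x ^ (M * (k + 1)) * Real.exp (-(B * L)) := by
    calc Real.exp (-t) * x ^ (M * (k + 1)) * 2 = Real.exp (-t) * 2 * x ^ (M * (k + 1)) := by ring
      _ ≤ Real.exp (-(B * L)) * x ^ (M * (k + 1)) :=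
        mul_le_mul_of_nonneg_right ha (pow_nonneg hxpos.le _)
      _ = x ^ (M * (k + 1)) * Real.exp (-(B * L)) := mul_comm _ _
  -- (b) the polynomially small term is at most half of the right-hand side
  have hb : x ^ M * 2 ≤ x ^ (M * (k + 1)) * Real.exp (-(B * L)) := by
    rw [hP, mul_assoc]
    exact mul_le_mul_of_nonneg_left hkey (pow_nonneg hxpos.le _)
  linarith

/-- **Stub 6 — polynomially small beats exponentially small.**
For `k ≥ 1` and `α, A, c > 0`, eventually in `n : ℕ` (with `M = ⌊α n⌋₊ · k`; the exponent
`⌊α n⌋₊ * k * (k + 1)` is `M (k+1)`):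
`e^(-cn) (2n)^(M(k+1)) + (2n)^M ≤ (2n)^(M(k+1)) e^(-4kA log(2n))`, i.e., after dividing by
`(2n)^(M(k+1)) > 0`, `e^(-cn) + (2n)^(-Mk) ≤ (2n)^(-4kA)`.  Proof: `log 2 + 4kA log(2n) ≤ cn`
eventually (`log = o(id)` along `2n → ∞`) handles the first summand, and `Mk ≥ 4kA + 1` eventually
(`⌊α n⌋₊ → ∞`, `k ≥ 1`) together with `log(2n) ≥ log 2` handles the second; see `asy_pointwise`. -/
theorem stub_asymptotics (k : ℕ) (hk : 1 ≤ k) (α A c : ℝ) (hα : 0 < α) (hA : 0 < A) (hc : 0 < c) :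
    ∀ᶠ n : ℕ in Filter.atTop,
      Real.exp (-(c * n)) * (2 * n : ℝ) ^ (⌊α * n⌋₊ * k * (k + 1)) + (2 * n : ℝ) ^ (⌊α * n⌋₊ * k)
        ≤ (2 * n : ℝ) ^ (⌊α * n⌋₊ * k * (k + 1)) * Real.exp (-(4 * k * A * Real.log (2 * n))) := by
  have hk1 : (1 : ℝ) ≤ k := by exact_mod_cast hk
  have hB : 0 < 4 * (k : ℝ) * A := by positivity
  filter_upwards [asy_log_bound_nat hB hc, asy_floor_large hα (4 * A + 1),
    Filter.eventually_ge_atTop 1] with n hlog hfl hn1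
  have hn1' : (1 : ℝ) ≤ n := by exact_mod_cast hn1
  have hx2 : (2 : ℝ) ≤ 2 * n := by linarith
  have hxpos : (0 : ℝ) < 2 * n := by linarith
  refine asy_pointwise (Real.exp_log hxpos) (Real.log_le_log two_pos hx2) hlog ?_
  -- `4kA + 1 ≤ ⌊α n⌋₊ k k`, from `4A + 1 ≤ ⌊α n⌋₊` and `k ≥ 1`
  have hkk : (1 : ℝ) ≤ (k : ℝ) * k := one_le_mul_of_one_le_of_one_le hk1 hk1
  have h1 : (4 * A + 1) * ((k : ℝ) * k) ≤ (⌊α * (n : ℝ)⌋₊ : ℝ) * ((k : ℝ) * k) :=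
    mul_le_mul_of_nonneg_right hfl (by positivity)
  have h2 : 4 * A * (k : ℝ) * 1 ≤ 4 * A * k * k := mul_le_mul_of_nonneg_left hk1 (by positivity)
  push_cast
  linarith

end Summit.PneNP.PneNP.Cruxes.SolvableImpliesStableSection.Sketch
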